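import Summits.Ventures.PercRepro.PuncturedLYMTwoHyperplaneDeletion
import Summits.Ventures.PercRepro.PuncturedLYMTwoHyperplaneGen

/-!
# PercRepro — THE POINTED LINE OF S5 FOR EVERY PAVING MATROID WITH TWO NONTRIVIAL HYPERPLANES (NO COVER CONDITION)
(p10, gen 35)

The general two-hyperplane theorem (PuncturedLYMTwoHyperplaneGen) applies to the DELETIONS of a two-hyperplane matroid
`IsTwoHyperplaneF' M r H₁ H₂`, so the pointed line of PuncturedLYMTwoHyperplaneDeletion transfers without the cover:
* `IsTwoHyperplaneF'.symm`, `dep_delete_iff_of_twoHyperplane'`, `rk_gr_delete_of_twoHyperplane'` (an `r`-set through a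
  point outside `H₁` and a point outside `H₂` — possibly the same point — is independent), `isUniformF_delete_of_subset'`,
  `isTwoHyperplaneF'_delete`, `isOneHyperplaneF_delete_of_twoHyperplane'`;
* **`normConsAt_delete_of_twoHyperplane'`** — (NC) at every deletion (`r + 2 ≤ n ≤ 2r − 2`);
* **the pointed line**: (H-gen), (PM-flat), (D-gen) (`r + 1 ≤ n ≤ 2r − 2`); (H), `out_k ≤ in_{k+1}`, (C1″), (D) at every
  point (`r + 2 ≤ n ≤ 2r − 2`) — all UNCONDITIONAL.
Nothing here asserts (SP), (PAV) or (NC) in general.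
-/

open scoped Matroid

namespace PercRepro.Cogirth

open Finset ThmH Skew

variable {α : Type} [DecidableEq α] {M : Matroid α} [M.Finite]

/-- The two-hyperplane predicate is symmetric in `(H₁, H₂)`. -/
theorem IsTwoHyperplaneF'.symm {r : ℕ} {H₁ H₂ : Finset α} (h2 : IsTwoHyperplaneF' M r H₁ H₂) :
    IsTwoHyperplaneF' M r H₂ H₁ := by
  obtain ⟨hrk, hp, h1g, h2g, h1n, h2n, hr1, hr2, hint, hH⟩ := h2
  refine ⟨hrk, hp, h2g, h1g, h2n, h1n, hr2, hr1, by rw [inter_comm]; exact hint, ?_⟩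
  intro S hS hSc
  rw [hH S hS hSc, or_comm]

/-- The dependent `r`-subsets of the deletion `M ∖ p` are the `r`-subsets of `H₁ ∖ p` or of `H₂ ∖ p`. -/
theorem dep_delete_iff_of_twoHyperplane' {r : ℕ} {H₁ H₂ : Finset α} (h2 : IsTwoHyperplaneF' M r H₁ H₂) (p : α) :
    ∀ S ⊆ gr (M ＼ ({p} : Set α)), S.card = r →
      (rk (M ＼ ({p} : Set α)) S ≠ S.card ↔ S ⊆ H₁.erase p ∨ S ⊆ H₂.erase p) := by
  obtain ⟨-, -, -, -, -, -, -, -, -, hH⟩ := h2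
  intro S hS hSc
  rw [gr_delete] at hS
  have hSg : S ⊆ gr M := hS.trans (erase_subset p (gr M))
  have hpS : p ∉ S := fun h => (mem_erase.1 (hS h)).1 rfl
  rw [rk_delete hSg hpS, hH S hSg hSc]
  have e : ∀ H : Finset α, (S ⊆ H ↔ S ⊆ H.erase p) := fun H =>
    ⟨fun h x hx => mem_erase.2 ⟨fun hxp => hpS (hxp ▸ hx), h hx⟩, fun h => h.trans (erase_subset p H)⟩
  rw [e H₁, e H₂]

/-- When `E ∖ p ⊄ H₁` and `E ∖ p ⊄ H₂`, the deletion of `p` from a two-hyperplane matroid still has rank `r`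
(`r + 2 ≤ n`): an `r`-set containing a point outside `H₁` and a point outside `H₂` is independent. -/
theorem rk_gr_delete_of_twoHyperplane' {r : ℕ} {H₁ H₂ : Finset α} (h2 : IsTwoHyperplaneF' M r H₁ H₂)
    (hr2 : r + 2 ≤ (gr M).card) {p : α} (hp : p ∈ gr M) (hn1 : ¬ (gr M).erase p ⊆ H₁)
    (hn2 : ¬ (gr M).erase p ⊆ H₂) : rk (M ＼ ({p} : Set α)) (gr (M ＼ ({p} : Set α))) = r := by
  obtain ⟨hrk, -, -, -, -, -, -, -, hint, hH⟩ := h2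
  rw [gr_delete, rk_delete (erase_subset p (gr M)) (notMem_erase p (gr M))]
  apply le_antisymm
  · rw [← hrk]
    exact rk_mono_of_subset (erase_subset p (gr M))
  · obtain ⟨x, hx, hxH⟩ := not_subset.1 hn1
    obtain ⟨y, hy, hyH⟩ := not_subset.1 hn2
    -- `Z = {x, y}` has one or two points; complete it to an `r`-set inside `E ∖ p`
    have hZ : ({x, y} : Finset α) ⊆ (gr M).erase p := by
      intro z hz
      rw [mem_insert, mem_singleton] at hz
      rcases hz with rfl | rfl
      · exact hx
      · exact hy
    have hZc : ({x, y} : Finset α).card ≤ 2 := card_le_two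
    have hZ1 : 1 ≤ ({x, y} : Finset α).card := card_pos.2 ⟨x, mem_insert_self x {y}⟩
    have hcard : r - ({x, y} : Finset α).card ≤ ((gr M).erase p \ {x, y}).card := by
      rw [card_sdiff_of_subset hZ, card_erase_of_mem hp]
      omega
    obtain ⟨T, hT, hTc⟩ := exists_subset_card_eq hcard
    have hdisj : Disjoint ({x, y} : Finset α) T := by
      rw [disjoint_left]
      intro z hz hzT
      exact (mem_sdiff.1 (hT hzT)).2 hz
    have hSg : ({x, y} : Finset α) ∪ T ⊆ (gr M).erase p := union_subset hZ (hT.trans sdiff_subset)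
    have hSc : (({x, y} : Finset α) ∪ T).card = r := by
      rw [card_union_of_disjoint hdisj, hTc]
      omega
    have hSi : rk M (({x, y} : Finset α) ∪ T) = (({x, y} : Finset α) ∪ T).card := by
      by_contra hne
      rcases (hH _ (hSg.trans (erase_subset p (gr M))) hSc).1 hne with h | h
      · exact hxH (h (mem_union_left T (mem_insert_self x {y})))
      · exact hyH (h (mem_union_left T (mem_insert_of_mem (mem_singleton_self y))))
    calc r = (({x, y} : Finset α) ∪ T).card := hSc.symm
      _ = rk M (({x, y} : Finset α) ∪ T) := hSi.symm
      _ ≤ rk M ((gr M).erase p) := rk_mono_of_subset hSg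

/-- When `E ∖ p ⊆ H₂`, the deletion of `p` from a two-hyperplane matroid is uniform (every `r`-subset of `E ∖ p` lies
in `H₂`, hence is dependent, so the deletion has rank at most `r − 1`, and every smaller set is independent). -/
theorem isUniformF_delete_of_subset_twoHyperplane' {r : ℕ} {H₁ H₂ : Finset α} (h2 : IsTwoHyperplaneF' M r H₁ H₂)
    {p : α} (hsub : (gr M).erase p ⊆ H₂) : IsUniformF (M ＼ ({p} : Set α)) := by
  obtain ⟨hrk, hpav, -, -, -, -, -, -, -, hH⟩ := h2
  have hgr : gr (M ＼ ({p} : Set α)) ⊆ (gr M).erase p := by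
    rw [gr_delete]
  have hrank : rk (M ＼ ({p} : Set α)) (gr (M ＼ ({p} : Set α))) + 1 ≤ r := by
    obtain ⟨B, hBg, hBc, hBi⟩ := exists_basis_finset (M := M ＼ ({p} : Set α))
    by_contra hcon
    have hrB : r ≤ B.card := by omega
    obtain ⟨S, hSB, hSc⟩ := exists_subset_card_eq hrB
    have hSi : (M ＼ ({p} : Set α)).Indep (S : Set α) := hBi.subset (by exact_mod_cast hSB)
    rw [Matroid.delete_indep_iff] at hSi
    have hSg : S ⊆ gr M := ((hSB.trans hBg).trans hgr).trans (erase_subset p (gr M))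
    have hSH : S ⊆ H₂ := ((hSB.trans hBg).trans hgr).trans hsub
    exact (hH S hSg hSc).2 (Or.inr hSH) ((indep_iff_rk_eq_card S).1 hSi.1)
  intro S hS hSc
  have hSg' : S ⊆ gr M := (hS.trans hgr).trans (erase_subset p (gr M))
  have hpS : p ∉ S := fun h => (mem_erase.1 (hgr (hS h))).1 rfl
  rw [rk_delete hSg' hpS]
  apply hpav S hSg'
  rw [hrk]
  omega

/-- When `E ∖ p ⊄ H₁, H₂` and both `H₁ ∖ p`, `H₂ ∖ p` have at least `r` points, the deletion is two-hyperplane with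
`H₁ ∖ p`, `H₂ ∖ p` (`r + 2 ≤ n`). -/
theorem isTwoHyperplaneF'_delete {r : ℕ} {H₁ H₂ : Finset α} (h2 : IsTwoHyperplaneF' M r H₁ H₂)
    (hr2 : r + 2 ≤ (gr M).card) {p : α} (hp : p ∈ gr M) (hn1 : ¬ (gr M).erase p ⊆ H₁)
    (hn2 : ¬ (gr M).erase p ⊆ H₂) (hc1 : r ≤ (H₁.erase p).card) (hc2 : r ≤ (H₂.erase p).card) :
    IsTwoHyperplaneF' (M ＼ ({p} : Set α)) r (H₁.erase p) (H₂.erase p) := by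
  have hrkd := rk_gr_delete_of_twoHyperplane' h2 hr2 hp hn1 hn2
  have hdep := dep_delete_iff_of_twoHyperplane' h2 p
  obtain ⟨-, hpav, h1g, h2g, -, -, -, -, hint, -⟩ := h2
  refine ⟨hrkd, isPaving_delete hpav p, ?_, ?_, ?_, ?_, hc1, hc2, ?_, hdep⟩
  · rw [gr_delete]
    exact erase_subset_erase p h1g
  · rw [gr_delete]
    exact erase_subset_erase p h2g
  · rw [gr_delete]
    apply card_lt_card
    refine Finset.ssubset_iff_subset_ne.2 ⟨erase_subset_erase p h1g, fun h => hn1 ?_⟩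
    rw [← h]
    exact erase_subset p H₁
  · rw [gr_delete]
    apply card_lt_card
    refine Finset.ssubset_iff_subset_ne.2 ⟨erase_subset_erase p h2g, fun h => hn2 ?_⟩
    rw [← h]
    exact erase_subset p H₂
  · have := card_le_card (inter_subset_inter (erase_subset p H₁) (erase_subset p H₂))
    omega

/-- When `E ∖ p ⊄ H₁, H₂` and `H₁ ∖ p` has fewer than `r` points, the deletion is one-hyperplane with `H₂ ∖ p`
(`r + 2 ≤ n`). -/
theorem isOneHyperplaneF_delete_of_twoHyperplane' {r : ℕ} {H₁ H₂ : Finset α} (h2 : IsTwoHyperplaneF' M r H₁ H₂)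
    (hr2 : r + 2 ≤ (gr M).card) {p : α} (hp : p ∈ gr M) (hn1 : ¬ (gr M).erase p ⊆ H₁)
    (hn2 : ¬ (gr M).erase p ⊆ H₂) (hc1 : (H₁.erase p).card < r) :
    IsOneHyperplaneF (M ＼ ({p} : Set α)) r (H₂.erase p) := by
  have hrkd := rk_gr_delete_of_twoHyperplane' h2 hr2 hp hn1 hn2
  have hdep := dep_delete_iff_of_twoHyperplane' h2 p
  obtain ⟨-, hpav, -, h2g, -, -, -, -, -, -⟩ := h2
  refine ⟨hrkd, isPaving_delete hpav p, ?_, ?_, ?_⟩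
  · rw [gr_delete]
    exact erase_subset_erase p h2g
  · rw [gr_delete]
    apply card_lt_card
    refine Finset.ssubset_iff_subset_ne.2 ⟨erase_subset_erase p h2g, fun h => hn2 ?_⟩
    rw [← h]
    exact erase_subset p H₂
  · intro S hS hSc
    rw [hdep S hS hSc]
    constructor
    · rintro (h | h)
      · have := card_le_card h
        omega
      · exact h
    · intro h
      exact Or.inr h

/-- **(NC) AT THE DELETION OF EVERY POINT OF A TWO-HYPERPLANE MATROID** with `r + 2 ≤ n ≤ 2r − 2`: uniform when
`E ∖ p ⊆ H₁` or `E ∖ p ⊆ H₂`, one-hyperplane when one of `H₁ ∖ p`, `H₂ ∖ p` has fewer than `r` points, two-hyperplane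
otherwise. -/
theorem normConsAt_delete_of_twoHyperplane' {r : ℕ} {H₁ H₂ : Finset α} (h2 : IsTwoHyperplaneF' M r H₁ H₂)
    (hr2 : r + 2 ≤ (gr M).card) (hn : (gr M).card + 2 ≤ 2 * r) {p : α} (hp : p ∈ gr M) :
    NormConsAt (M ＼ ({p} : Set α)) := by
  rcases Decidable.em ((gr M).erase p ⊆ H₁) with hs1 | hn1
  · exact normConsAt_of_uniform (isUniformF_delete_of_subset_twoHyperplane' h2.symm hs1)
  rcases Decidable.em ((gr M).erase p ⊆ H₂) with hs2 | hn2
  · exact normConsAt_of_uniform (isUniformF_delete_of_subset_twoHyperplane' h2 hs2)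
  have hN := card_gr_delete (M := M) hp
  rcases Nat.lt_or_ge (H₁.erase p).card r with hc1 | hc1
  · exact normConsAt_of_oneHyperplane' (isOneHyperplaneF_delete_of_twoHyperplane' h2 hr2 hp hn1 hn2 hc1)
      (by rw [hN]; omega) (by rw [hN]; omega)
  rcases Nat.lt_or_ge (H₂.erase p).card r with hc2 | hc2
  · exact normConsAt_of_oneHyperplane' (isOneHyperplaneF_delete_of_twoHyperplane' h2.symm hr2 hp hn2 hn1 hc2)
      (by rw [hN]; omega) (by rw [hN]; omega)
  · exact normConsAt_of_twoHyperplane_gen (isTwoHyperplaneF'_delete h2 hr2 hp hn1 hn2 hc1 hc2)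
      (by rw [hN]; omega) (by rw [hN]; omega)

/-- **(D-gen) at the deletion of every point of a two-hyperplane matroid** with `r + 2 ≤ n ≤ 2r − 2`. -/
theorem avoidRowUpsetAt_delete_of_twoHyperplane' {r : ℕ} {H₁ H₂ : Finset α} (h2 : IsTwoHyperplaneF' M r H₁ H₂)
    (hr2 : r + 2 ≤ (gr M).card) (hn : (gr M).card + 2 ≤ 2 * r) {p : α} (hp : p ∈ gr M) :
    AvoidRowUpsetAt (M ＼ ({p} : Set α)) := by
  have hN := card_gr_delete (M := M) hp
  have hNC := normConsAt_delete_of_twoHyperplane' h2 hr2 hn hp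
  rcases Decidable.em ((gr M).erase p ⊆ H₁) with hs1 | hn1
  · have hu := isUniformF_delete_of_subset_twoHyperplane' h2.symm hs1
    exact avoidRowUpsetAt_of_normConsAt_of_step (fun _ hk => density_step_of_uniform hu hk) hNC
  rcases Decidable.em ((gr M).erase p ⊆ H₂) with hs2 | hn2
  · have hu := isUniformF_delete_of_subset_twoHyperplane' h2 hs2
    exact avoidRowUpsetAt_of_normConsAt_of_step (fun _ hk => density_step_of_uniform hu hk) hNC
  · have hrkd := rk_gr_delete_of_twoHyperplane' h2 hr2 hp hn1 hn2
    exact avoidRowUpsetAt_of_normConsAt_of_step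
      (fun _ hk => density_step_of_paving (isPaving_delete h2.2.1 p) hrkd (by rw [hN]; omega) hk) hNC

/-! ### The pointed line for two-hyperplane matroids -/

/-- **(H-gen) for every two-hyperplane matroid** with `r + 1 ≤ n ≤ 2r − 2` (closure form). -/
theorem upsetMirrorAt_of_twoHyperplane' {r : ℕ} {H₁ H₂ : Finset α} (h2 : IsTwoHyperplaneF' M r H₁ H₂)
    (hr1 : r + 1 ≤ (gr M).card) (hn : (gr M).card + 2 ≤ 2 * r) : UpsetMirrorAt M :=
  upsetMirrorAt_of_normConsAt (normConsAt_of_twoHyperplane_gen h2 hr1 hn)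

/-- **(H-gen) for every two-hyperplane matroid** with `r + 1 ≤ n ≤ 2r − 2` (separated-set form). -/
theorem sepMirrorAt_of_twoHyperplane' {r : ℕ} {H₁ H₂ : Finset α} (h2 : IsTwoHyperplaneF' M r H₁ H₂)
    (hr1 : r + 1 ≤ (gr M).card) (hn : (gr M).card + 2 ≤ 2 * r) : SepMirrorAt M :=
  sepMirrorAt_of_upsetMirrorAt (upsetMirrorAt_of_twoHyperplane' h2 hr1 hn)

/-- **(PM-flat) for every two-hyperplane matroid** with `r + 1 ≤ n ≤ 2r − 2`. -/
theorem biIndepFlatSupAt_of_twoHyperplane' {r : ℕ} {H₁ H₂ : Finset α} (h2 : IsTwoHyperplaneF' M r H₁ H₂)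
    (hr1 : r + 1 ≤ (gr M).card) (hn : (gr M).card + 2 ≤ 2 * r) : BiIndepFlatSupAt M :=
  flatSupAt_of_flatSupHallAt (flatSupHallAt_of_upsetMirrorAt (upsetMirrorAt_of_twoHyperplane' h2 hr1 hn))

/-- **(H) at every point of every two-hyperplane matroid** with `r + 2 ≤ n ≤ 2r − 2`. -/
theorem capMirrorAt_of_twoHyperplane' {r : ℕ} {H₁ H₂ : Finset α} (h2 : IsTwoHyperplaneF' M r H₁ H₂)
    (hr2 : r + 2 ≤ (gr M).card) (hn : (gr M).card + 2 ≤ 2 * r) {p : α} (hp : p ∈ gr M) : CapMirrorAt M p := by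
  intro k hk
  have hN := card_gr_delete (M := M) hp
  have hsep := sepMirrorAt_of_upsetMirrorAt
    (upsetMirrorAt_of_normConsAt (normConsAt_delete_of_twoHyperplane' h2 hr2 hn hp))
  have h := hsep (modCut M p) (upFlats_modCut p) k (by rw [hN]; omega)
  rw [hN, ← capCount_eq_sepCount_delete_modCut hp, ← capCount_eq_sepCount_delete_modCut hp,
    show (gr M).card - 1 - k = (gr M).card - (k + 1) by omega] at h
  exact h

/-- The per-point form `out_k ≤ in_{k+1}` of Theorem A at every point of every two-hyperplane matroid with
`r + 2 ≤ n ≤ 2r − 2` (`2k + 2 ≤ n`). -/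
theorem outCount_le_inCount_succ_of_twoHyperplane' {r : ℕ} {H₁ H₂ : Finset α} (h2 : IsTwoHyperplaneF' M r H₁ H₂)
    (hr2 : r + 2 ≤ (gr M).card) (hn : (gr M).card + 2 ≤ 2 * r) {p : α} (hp : p ∈ gr M) {k : ℕ}
    (hk : 2 * k + 2 ≤ (gr M).card) : outCount M k p ≤ inCount M (k + 1) p :=
  (outCount_le_inCount_succ_iff hp (by omega)).2 (capMirrorAt_of_twoHyperplane' h2 hr2 hn hp k hk)

/-- **(C1″) at every point of every two-hyperplane matroid** with `r + 2 ≤ n ≤ 2r − 2`. -/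
theorem capLimitPlus_body_of_twoHyperplane' {r : ℕ} {H₁ H₂ : Finset α} (h2 : IsTwoHyperplaneF' M r H₁ H₂)
    (hr2 : r + 2 ≤ (gr M).card) (hn : (gr M).card + 2 ≤ 2 * r) {p : α} (hp : p ∈ gr M) :
    ((gr M).card - 1) * ∑ k ∈ range ((gr M).card + 1), capCount M k p ≤
      2 * ∑ k ∈ range ((gr M).card + 1), k * capCount M k p :=
  capLimitPlus_body_of_capMirrorAt hp (capMirrorAt_of_twoHyperplane' h2 hr2 hn hp)

/-- **(D-gen) for every two-hyperplane matroid** with `r + 1 ≤ n ≤ 2r − 2`. -/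
theorem avoidRowUpsetAt_of_twoHyperplane' {r : ℕ} {H₁ H₂ : Finset α} (h2 : IsTwoHyperplaneF' M r H₁ H₂)
    (hr1 : r + 1 ≤ (gr M).card) (hn : (gr M).card + 2 ≤ 2 * r) : AvoidRowUpsetAt M :=
  avoidRowUpsetAt_of_normConsAt_of_step (fun _ hk => density_step_of_paving h2.2.1 h2.1 hn hk)
    (normConsAt_of_twoHyperplane_gen h2 hr1 hn)

/-- **(D) at every point of every two-hyperplane matroid** with `r + 2 ≤ n ≤ 2r − 2`:
`(n − k − 1)·out_k ≤ (k + 1)·out_{k+1}` for `2k + 2 ≤ n`. -/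
theorem avoidRowAt_of_twoHyperplane' {r : ℕ} {H₁ H₂ : Finset α} (h2 : IsTwoHyperplaneF' M r H₁ H₂)
    (hr2 : r + 2 ≤ (gr M).card) (hn : (gr M).card + 2 ≤ 2 * r) {p : α} (hp : p ∈ gr M) : AvoidRowAt M p := by
  intro k hk
  have hN := card_gr_delete (M := M) hp
  have h := avoidRowUpsetAt_delete_of_twoHyperplane' h2 hr2 hn hp (modCut M p) (upFlats_modCut p) k
    (by rw [hN]; omega)
  rw [avoidUpCount_modCut_eq_outCount hp, avoidUpCount_modCut_eq_outCount hp, hN] at h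
  rwa [show (gr M).card - k - 1 = (gr M).card - 1 - k by omega]

end PercRepro.Cogirth
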